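import Summits.CriticalPhenomena.PercolationContinuityZ3.Theorems.PercNearOneGluingNoHeavyLowerTailSahiRootSideSep
import HarnessLib

/-!
# Root-side reduction, II: the root side is felt only through three numbers; the three numbers of a claw

Support file for the Sahi programme (`--supports stmt-CriticalPhenomena-4575`, prover prim-sahi-p2 gen 12).
No definitions, no named facts, no sorries; standard axioms.  Memo `…/prim-sahi-p2/PROOF-E3.md` §23.

Setting of Part I (`…SahiRootSideSep`): a root side `R ∋ s` separated from the rest by `{u, v}` (no pair of positive
weight from `R` to the outside of `R ∪ {u,v}`); root-side connections `{s ↔_R x}` use open pairs meeting `R`.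

* `real_principal_rootSide_congr`: two weights with the no-exit property for `R`, equal on the pairs not meeting `R`, and
  with the same three root-side cell probabilities `P(s ↔_R u, s ↮_R v)`, `P(s ↮_R u, s ↔_R v)`, `P(s ↔_R u, s ↔_R v)`
  give the same probability to every principal cluster event `{C_s ⊇ U}` with `U ∩ R = ∅` (Part I's decomposition +
  locality of the outside events).
* `sahiE_principal_rootSide_congr`: hence the same Sahi functional `E_n` for every family of such events (`E_n` sees only
  product moments, `TwoChainUnions.sahiE_congr_of_prodMoments`).
* `rootSide_conn_claw_iff`, `real_rootSide_cells_claw`: for a CLAW root side — the root `s` joined to a hub `h ∈ R` with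
  probability `ρ`, the hub joined to `u` and `v` with probabilities `α`, `β`, every other pair meeting `R` of weight `0` —
  the three numbers are `ρα(1−β)`, `ρβ(1−α)`, `ραβ`.
Part III (`…SahiRootSideClaw`) supplies, for every root side, a claw with the same three numbers (Harris' inequality makes
the rational parameters feasible) and draws the consequences via the cut-vertex theorems.
-/

noncomputable section

namespace Summit.CriticalPhenomena.PercolationContinuityZ3.Theorems

namespace SahiRootSide

open Finset MeasureTheory Literature.Combinatorics.Sahi2008 Literature.Probability.Percolation
  Literature.Probability.LatticeModels
open Literature.Probability.Percolation.DecisionTree (ind ind_of_mem ind_of_not_mem ind_nonneg)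
open scoped Classical

variable {V : Type*} [Fintype V]

omit [Fintype V] in
/-- Products of indicators are indicators of intersections (plumbing). [folklore] -/
private theorem prod_ind_eq_ind_biInter {α ι : Type*} (S : Finset ι) (A : ι → Set α) :
    ∏ i ∈ S, ind (A i) = ind (⋂ i ∈ S, A i) := by
  classical
  induction S using Finset.induction_on with
  | empty => funext a; simp [ind_of_mem]
  | insert a S ha ih =>
    rw [Finset.prod_insert ha, ih]
    funext z
    rw [Pi.mul_apply, ← BHK2006.ind_inter]
    congr 1
    ext z'
    simp

/-- **Congruence.**  Two weights with the no-exit property for the root side `R ∋ s`, equal on the pairs not meeting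
`R`, and with the same three root-side cell probabilities `P(s ↔_R u, s ↮_R v)`, `P(s ↮_R u, s ↔_R v)`,
`P(s ↔_R u, s ↔_R v)`, give the same probability to every principal cluster event `{C_s ⊇ U}` with `U ∩ R = ∅`:
the root side is felt only through these three numbers. [this work] -/
theorem real_principal_rootSide_congr (w w' : Sym2 V → unitInterval) (R : Finset V) {s u v : V} (hs : s ∈ R)
    (hw : ∀ x ∈ R, ∀ z, z ∉ R → z ≠ u → z ≠ v → w s(x, z) = 0)
    (hw' : ∀ x ∈ R, ∀ z, z ∉ R → z ≠ u → z ≠ v → w' s(x, z) = 0)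
    (hoff : ∀ e : Sym2 V, (∀ y ∈ R, y ∉ e) → w' e = w e)
    (hcu : (prodBernoulli w').real {ω | ω ∩ {e : Sym2 V | ∃ y ∈ (R : Set V), y ∈ e} ∈
        (openConn s u : Set (BondConfig V)) ∧ ω ∩ {e : Sym2 V | ∃ y ∈ (R : Set V), y ∈ e} ∉
        (openConn s v : Set (BondConfig V))} =
      (prodBernoulli w).real {ω | ω ∩ {e : Sym2 V | ∃ y ∈ (R : Set V), y ∈ e} ∈
        (openConn s u : Set (BondConfig V)) ∧ ω ∩ {e : Sym2 V | ∃ y ∈ (R : Set V), y ∈ e} ∉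
        (openConn s v : Set (BondConfig V))})
    (hcv : (prodBernoulli w').real {ω | ω ∩ {e : Sym2 V | ∃ y ∈ (R : Set V), y ∈ e} ∉
        (openConn s u : Set (BondConfig V)) ∧ ω ∩ {e : Sym2 V | ∃ y ∈ (R : Set V), y ∈ e} ∈
        (openConn s v : Set (BondConfig V))} =
      (prodBernoulli w).real {ω | ω ∩ {e : Sym2 V | ∃ y ∈ (R : Set V), y ∈ e} ∉
        (openConn s u : Set (BondConfig V)) ∧ ω ∩ {e : Sym2 V | ∃ y ∈ (R : Set V), y ∈ e} ∈
        (openConn s v : Set (BondConfig V))})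
    (hcuv : (prodBernoulli w').real {ω | ω ∩ {e : Sym2 V | ∃ y ∈ (R : Set V), y ∈ e} ∈
        (openConn s u : Set (BondConfig V)) ∧ ω ∩ {e : Sym2 V | ∃ y ∈ (R : Set V), y ∈ e} ∈
        (openConn s v : Set (BondConfig V))} =
      (prodBernoulli w).real {ω | ω ∩ {e : Sym2 V | ∃ y ∈ (R : Set V), y ∈ e} ∈
        (openConn s u : Set (BondConfig V)) ∧ ω ∩ {e : Sym2 V | ∃ y ∈ (R : Set V), y ∈ e} ∈
        (openConn s v : Set (BondConfig V))})
    (U : Finset V) (hU : ∀ t ∈ U, t ∉ R) :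
    (prodBernoulli w).real (⋂ t ∈ U, (openConn s t : Set (BondConfig V))) =
      (prodBernoulli w').real (⋂ t ∈ U, (openConn s t : Set (BondConfig V))) := by
  rcases U.eq_empty_or_nonempty with hU0 | hU0
  · subst hU0; simp
  rw [real_principal_rootSide_eq w R hs hw U hU0 hU, real_principal_rootSide_eq w' R hs hw' U hU0 hU, hcu, hcv, hcuv]
  -- the outside events have the same probability under `w` and `w'`
  have hm : ∀ X : Set (BondConfig V), MeasurableSet X := fun _ => MeasurableSet.of_discrete
  have hpq : ∀ e ∈ ({e : Sym2 V | ∃ y ∈ (R : Set V), y ∈ e}ᶜ : Set (Sym2 V)), w e = w' e := by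
    intro e he
    refine (hoff e fun y hy hye => he ⟨y, Finset.mem_coe.2 hy, hye⟩).symm
  have hdO : ∀ x t : V, DeterminedBy (openConnIn (↑R)ᶜ x t : Set (BondConfig V))
      {e : Sym2 V | ∃ y ∈ (R : Set V), y ∈ e}ᶜ := fun x t => determinedBy_openConnIn_compl (↑R) x t
  have hO : ∀ x : V, (prodBernoulli w).real (⋂ t ∈ U, (openConnIn (↑R)ᶜ x t : Set (BondConfig V))) =
      (prodBernoulli w').real (⋂ t ∈ U, (openConnIn (↑R)ᶜ x t : Set (BondConfig V))) := by
    intro x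
    refine prodBernoulli_real_eq_of_determinedBy w w' hpq ((determinedBy_iff _ _).2 fun ω ω' h => ?_) (hm _)
    simp only [Set.mem_iInter]
    exact forall₂_congr fun t _ => (determinedBy_iff _ _).1 (hdO x t) ω ω' h
  have hOuv : (prodBernoulli w).real (⋂ t ∈ U, (openConnIn (↑R)ᶜ u t ∪ openConnIn (↑R)ᶜ v t :
      Set (BondConfig V))) = (prodBernoulli w').real (⋂ t ∈ U, (openConnIn (↑R)ᶜ u t ∪ openConnIn (↑R)ᶜ v t :
      Set (BondConfig V))) := by
    refine prodBernoulli_real_eq_of_determinedBy w w' hpq ((determinedBy_iff _ _).2 fun ω ω' h => ?_) (hm _)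
    simp only [Set.mem_iInter, Set.mem_union]
    exact forall₂_congr fun t _ => or_congr ((determinedBy_iff _ _).1 (hdO u t) ω ω' h)
      ((determinedBy_iff _ _).1 (hdO v t) ω ω' h)
  rw [hO u, hO v, hOuv]

/-- **Congruence for Sahi functionals.**  Under the hypotheses of `real_principal_rootSide_congr`, every Sahi
functional `E_n` of every family of principal cluster events `{C_s ⊇ T_i}` with targets outside `R` is the same
for `w` and `w'` (`E_n` only sees product moments, which are principal probabilities). [this work] -/
theorem sahiE_principal_rootSide_congr (w w' : Sym2 V → unitInterval) (R : Finset V) {s u v : V} (hs : s ∈ R)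
    (hw : ∀ x ∈ R, ∀ z, z ∉ R → z ≠ u → z ≠ v → w s(x, z) = 0)
    (hw' : ∀ x ∈ R, ∀ z, z ∉ R → z ≠ u → z ≠ v → w' s(x, z) = 0)
    (hoff : ∀ e : Sym2 V, (∀ y ∈ R, y ∉ e) → w' e = w e)
    (hcu : (prodBernoulli w').real {ω | ω ∩ {e : Sym2 V | ∃ y ∈ (R : Set V), y ∈ e} ∈
        (openConn s u : Set (BondConfig V)) ∧ ω ∩ {e : Sym2 V | ∃ y ∈ (R : Set V), y ∈ e} ∉
        (openConn s v : Set (BondConfig V))} =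
      (prodBernoulli w).real {ω | ω ∩ {e : Sym2 V | ∃ y ∈ (R : Set V), y ∈ e} ∈
        (openConn s u : Set (BondConfig V)) ∧ ω ∩ {e : Sym2 V | ∃ y ∈ (R : Set V), y ∈ e} ∉
        (openConn s v : Set (BondConfig V))})
    (hcv : (prodBernoulli w').real {ω | ω ∩ {e : Sym2 V | ∃ y ∈ (R : Set V), y ∈ e} ∉
        (openConn s u : Set (BondConfig V)) ∧ ω ∩ {e : Sym2 V | ∃ y ∈ (R : Set V), y ∈ e} ∈
        (openConn s v : Set (BondConfig V))} =
      (prodBernoulli w).real {ω | ω ∩ {e : Sym2 V | ∃ y ∈ (R : Set V), y ∈ e} ∉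
        (openConn s u : Set (BondConfig V)) ∧ ω ∩ {e : Sym2 V | ∃ y ∈ (R : Set V), y ∈ e} ∈
        (openConn s v : Set (BondConfig V))})
    (hcuv : (prodBernoulli w').real {ω | ω ∩ {e : Sym2 V | ∃ y ∈ (R : Set V), y ∈ e} ∈
        (openConn s u : Set (BondConfig V)) ∧ ω ∩ {e : Sym2 V | ∃ y ∈ (R : Set V), y ∈ e} ∈
        (openConn s v : Set (BondConfig V))} =
      (prodBernoulli w).real {ω | ω ∩ {e : Sym2 V | ∃ y ∈ (R : Set V), y ∈ e} ∈
        (openConn s u : Set (BondConfig V)) ∧ ω ∩ {e : Sym2 V | ∃ y ∈ (R : Set V), y ∈ e} ∈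
        (openConn s v : Set (BondConfig V))})
    (n : ℕ) (T : Fin n → Finset V) (hT : ∀ i, ∀ t ∈ T i, t ∉ R) :
    sahiE (bernoulliWeight w) n (fun i => ind (⋂ t ∈ T i, (openConn s t : Set (BondConfig V)))) =
      sahiE (bernoulliWeight w') n (fun i => ind (⋂ t ∈ T i, (openConn s t : Set (BondConfig V)))) := by
  refine TwoChainUnions.sahiE_congr_of_prodMoments _ _ n _ _ fun S => ?_
  have hset : (⋂ i ∈ S, ⋂ t ∈ T i, (openConn s t : Set (BondConfig V))) =
      ⋂ t ∈ S.biUnion T, (openConn s t : Set (BondConfig V)) := by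
    ext ω
    simp only [Set.mem_iInter, Finset.mem_biUnion]
    constructor
    · rintro h t ⟨i, hi, ht⟩
      exact h i hi t ht
    · intro h i hi t ht
      exact h t ⟨i, hi, ht⟩
  rw [prod_ind_eq_ind_biInter, ex_bernoulliWeight_ind, ex_bernoulliWeight_ind, hset]
  refine real_principal_rootSide_congr w w' R hs hw hw' hoff hcu hcv hcuv (S.biUnion T) fun t ht => ?_
  obtain ⟨i, -, hi⟩ := Finset.mem_biUnion.1 ht
  exact hT i t hi


/-! ### Plumbing -/

omit [Fintype V] in
/-- Indicators of events with the same membership agree (plumbing). [folklore] -/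
private theorem ind_congr_mem' {α : Type*} {A B : Set α} {a : α} (h : a ∈ A ↔ a ∈ B) : ind A a = ind B a := by
  by_cases ha : a ∈ A
  · rw [ind_of_mem ha, ind_of_mem (h.1 ha)]
  · rw [ind_of_not_mem ha, ind_of_not_mem (fun hb => ha (h.2 hb))]

omit [Fintype V] in
/-- A vertex reachable from a different vertex has a neighbour (first step of a walk). [folklore] -/
private theorem exists_adj_of_reachable {G : SimpleGraph V} {a b : V} (h : G.Reachable a b) (hab : a ≠ b) :
    ∃ z, G.Adj a z := by
  obtain ⟨p⟩ := h
  cases p with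
  | nil => exact absurd rfl hab
  | cons hadj _ => exact ⟨_, hadj⟩

omit [Fintype V] in
/-- The coordinate event `{e ∈ ω}` is determined by the coordinate `e`. [folklore] -/
private theorem determinedBy_mem (e : Sym2 V) : DeterminedBy {ω : BondConfig V | e ∈ ω} ({e} : Finset (Sym2 V)) :=
  (determinedBy_iff _ _).2 fun ω ω' h => by
    have := Set.ext_iff.1 h e
    simp only [Finset.coe_singleton, Set.mem_inter_iff, Set.mem_singleton_iff, and_true] at this
    exact this

/-! ### The claw -/

omit [Fintype V] in
/-- **Connections in a claw root side.**  If the open pairs meeting `R` are among `s(s,h), s(h,x), s(h,y)` (with `s, h ∈ R`,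
`s ≠ h`, `x, y ∉ R`, `x ≠ y`), then `s` is joined to `x` by open pairs meeting `R` iff `s(s,h)` and `s(h,x)` are open.
[this work] -/
theorem rootSide_conn_claw_iff {R : Set V} {s h x y : V} (hs : s ∈ R) (hh : h ∈ R) (hsh : s ≠ h) (hx : x ∉ R)
    (hy : y ∉ R) (hxy : x ≠ y) {ω : BondConfig V}
    (hω : ∀ e : Sym2 V, (∃ z ∈ R, z ∈ e) → e ∈ ω → e = s(s, h) ∨ e = s(h, x) ∨ e = s(h, y)) :
    ω ∩ {e : Sym2 V | ∃ z ∈ R, z ∈ e} ∈ (openConn s x : Set (BondConfig V)) ↔ s(s, h) ∈ ω ∧ s(h, x) ∈ ω := by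
  have hsx : s ≠ x := fun h' => hx (h' ▸ hs)
  have hhx : h ≠ x := fun h' => hx (h' ▸ hh)
  have hhy : h ≠ y := fun h' => hy (h' ▸ hh)
  have hsy : s ≠ y := fun h' => hy (h' ▸ hs)
  constructor
  · intro hreach
    have hreach : (openGraph (ω ∩ {e : Sym2 V | ∃ z ∈ R, z ∈ e})).Reachable s x := hreach
    -- first step from `s`: the pair is `s(s,h)`
    obtain ⟨z, hz⟩ := exists_adj_of_reachable hreach hsx
    rw [openGraph_adj] at hz
    obtain ⟨⟨hzω, hzF⟩, -⟩ := hz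
    have h1 : s(s, h) ∈ ω := by
      rcases hω _ hzF hzω with he | he | he
      · exact he ▸ hzω
      · rcases Sym2.eq_iff.1 he with ⟨h1, -⟩ | ⟨h1, -⟩
        · exact absurd h1 hsh
        · exact absurd h1 hsx
      · rcases Sym2.eq_iff.1 he with ⟨h1, -⟩ | ⟨h1, -⟩
        · exact absurd h1 hsh
        · exact absurd h1 hsy
    -- first step from `x`: the pair is `s(h,x)`
    obtain ⟨z', hz'⟩ := exists_adj_of_reachable hreach.symm (Ne.symm hsx)
    rw [openGraph_adj] at hz'
    obtain ⟨⟨hz'ω, hz'F⟩, -⟩ := hz'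
    have h2 : s(h, x) ∈ ω := by
      rcases hω _ hz'F hz'ω with he | he | he
      · rcases Sym2.eq_iff.1 he with ⟨h1, -⟩ | ⟨h1, -⟩
        · exact absurd h1.symm hsx
        · exact absurd h1.symm hhx
      · exact he ▸ hz'ω
      · rcases Sym2.eq_iff.1 he with ⟨h1, -⟩ | ⟨h1, -⟩
        · exact absurd h1.symm hhx
        · exact absurd h1 hxy
    exact ⟨h1, h2⟩
  · rintro ⟨h1, h2⟩
    have a1 : (openGraph (ω ∩ {e : Sym2 V | ∃ z ∈ R, z ∈ e})).Adj s h :=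
      rootSide_adj h1 hsh (Or.inl hs)
    have a2 : (openGraph (ω ∩ {e : Sym2 V | ∃ z ∈ R, z ∈ e})).Adj h x :=
      rootSide_adj h2 hhx (Or.inl hh)
    exact a1.reachable.trans a2.reachable

/-- **The three root-side numbers of a claw.**  For a weight whose pairs meeting `R` all vanish except possibly
`s(s,h), s(h,u), s(h,v)` (with `s ≠ h` in `R`, `u ≠ v` outside), the cells `P(s ↔_R u, s ↮_R v)`, `P(s ↮_R u, s ↔_R v)`,
`P(s ↔_R u, s ↔_R v)` are `ρα(1−β)`, `ρβ(1−α)`, `ραβ` with `ρ, α, β` the weights of the three claw pairs. [this work] -/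
theorem real_rootSide_cells_claw (w' : Sym2 V → unitInterval) (R : Finset V) {s h u v : V} (hs : s ∈ R) (hh : h ∈ R)
    (hsh : s ≠ h) (hu : u ∉ R) (hv : v ∉ R) (huv : u ≠ v)
    (hzero : ∀ e : Sym2 V, (∃ y ∈ R, y ∈ e) → e ≠ s(s, h) → e ≠ s(h, u) → e ≠ s(h, v) → w' e = 0) :
    (prodBernoulli w').real {ω | ω ∩ {e : Sym2 V | ∃ y ∈ (R : Set V), y ∈ e} ∈ (openConn s u : Set (BondConfig V)) ∧
        ω ∩ {e : Sym2 V | ∃ y ∈ (R : Set V), y ∈ e} ∉ (openConn s v : Set (BondConfig V))} =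
      (w' s(s, h) : ℝ) * w' s(h, u) * (1 - w' s(h, v)) ∧
    (prodBernoulli w').real {ω | ω ∩ {e : Sym2 V | ∃ y ∈ (R : Set V), y ∈ e} ∉ (openConn s u : Set (BondConfig V)) ∧
        ω ∩ {e : Sym2 V | ∃ y ∈ (R : Set V), y ∈ e} ∈ (openConn s v : Set (BondConfig V))} =
      (w' s(s, h) : ℝ) * w' s(h, v) * (1 - w' s(h, u)) ∧
    (prodBernoulli w').real {ω | ω ∩ {e : Sym2 V | ∃ y ∈ (R : Set V), y ∈ e} ∈ (openConn s u : Set (BondConfig V)) ∧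
        ω ∩ {e : Sym2 V | ∃ y ∈ (R : Set V), y ∈ e} ∈ (openConn s v : Set (BondConfig V))} =
      (w' s(s, h) : ℝ) * w' s(h, u) * w' s(h, v) := by
  set F : Set (Sym2 V) := {e : Sym2 V | ∃ y ∈ (R : Set V), y ∈ e} with hF
  -- on configurations of positive weight the open root-side pairs are claw pairs
  have hgood : ∀ ω : BondConfig V, bernoulliWeight w' ω ≠ 0 →
      ∀ e : Sym2 V, (∃ z ∈ (R : Set V), z ∈ e) → e ∈ ω → e = s(s, h) ∨ e = s(h, u) ∨ e = s(h, v) := by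
    intro ω hω e he heω
    by_contra hne
    push Not at hne
    obtain ⟨z, hz, hze⟩ := he
    exact hω (IncStarCycle.bernoulliWeight_eq_zero_of_mem w' heω
      (hzero e ⟨z, Finset.mem_coe.1 hz, hze⟩ hne.1 hne.2.1 hne.2.2))
  have hsR : s ∈ (R : Set V) := Finset.mem_coe.2 hs
  have hhR : h ∈ (R : Set V) := Finset.mem_coe.2 hh
  have huR : u ∉ (R : Set V) := fun h => hu (Finset.mem_coe.1 h)
  have hvR : v ∉ (R : Set V) := fun h => hv (Finset.mem_coe.1 h)
  have hU : ∀ ω : BondConfig V, bernoulliWeight w' ω ≠ 0 →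
      (ω ∩ F ∈ (openConn s u : Set (BondConfig V)) ↔ s(s, h) ∈ ω ∧ s(h, u) ∈ ω) :=
    fun ω hω => rootSide_conn_claw_iff hsR hhR hsh huR hvR huv (hgood ω hω)
  have hV' : ∀ ω : BondConfig V, bernoulliWeight w' ω ≠ 0 →
      (ω ∩ F ∈ (openConn s v : Set (BondConfig V)) ↔ s(s, h) ∈ ω ∧ s(h, v) ∈ ω) :=
    fun ω hω => rootSide_conn_claw_iff hsR hhR hsh hvR huR huv.symm fun e he heω => by
      rcases hgood ω hω e he heω with h | h | h
      exacts [Or.inl h, Or.inr (Or.inr h), Or.inr (Or.inl h)]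
  -- transfer of probabilities along a.s. equal memberships
  have htransfer : ∀ {A B : Set (BondConfig V)}, (∀ ω, bernoulliWeight w' ω ≠ 0 → (ω ∈ A ↔ ω ∈ B)) →
      (prodBernoulli w').real A = (prodBernoulli w').real B := by
    intro A B hAB
    simp only [prodBernoulli_real_eq_sum_weight_ind]
    refine Finset.sum_congr rfl fun ω _ => ?_
    by_cases hω : bernoulliWeight w' ω = 0
    · have : BHK2006.weight (fun e => (w' e : ℝ)) ω = 0 := hω
      rw [this, zero_mul, zero_mul]
    · rw [ind_congr_mem' (hAB ω hω)]
  -- the three pairs are distinct coordinates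
  have hsu : s ≠ u := fun h' => hu (h' ▸ hs)
  have hsv : s ≠ v := fun h' => hv (h' ▸ hs)
  have hhu : h ≠ u := fun h' => hu (h' ▸ hh)
  have hhv : h ≠ v := fun h' => hv (h' ▸ hh)
  have d12 : s(s, h) ≠ s(h, u) := fun he => by
    rcases Sym2.eq_iff.1 he with ⟨h1, -⟩ | ⟨h1, -⟩; exacts [hsh h1, hsu h1]
  have d13 : s(s, h) ≠ s(h, v) := fun he => by
    rcases Sym2.eq_iff.1 he with ⟨h1, -⟩ | ⟨h1, -⟩; exacts [hsh h1, hsv h1]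
  have d23 : s(h, u) ≠ s(h, v) := fun he => by
    rcases Sym2.eq_iff.1 he with ⟨-, h1⟩ | ⟨h1, -⟩; exacts [huv h1, hhv h1]
  have hm : ∀ X : Set (BondConfig V), MeasurableSet X := fun _ => MeasurableSet.of_discrete
  -- probability of `{e₁ open, e₂ open, e₃ in state b}`
  have hthree : ∀ {e₁ e₂ e₃ : Sym2 V}, e₁ ≠ e₂ → e₁ ≠ e₃ → e₂ ≠ e₃ →
      (prodBernoulli w').real ({ω | e₁ ∈ ω} ∩ {ω | e₂ ∈ ω} ∩ {ω | e₃ ∉ ω}) =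
        (w' e₁ : ℝ) * w' e₂ * (1 - w' e₃) ∧
      (prodBernoulli w').real ({ω | e₁ ∈ ω} ∩ {ω | e₂ ∈ ω} ∩ {ω | e₃ ∈ ω}) = (w' e₁ : ℝ) * w' e₂ * w' e₃ := by
    intro e₁ e₂ e₃ h12 h13 h23
    have hd12 : DeterminedBy ({ω : BondConfig V | e₁ ∈ ω} ∩ {ω | e₂ ∈ ω}) (↑({e₁, e₂} : Finset (Sym2 V))) :=
      (determinedBy_iff _ _).2 fun ω ω' hωω' => by
        have k1 := Set.ext_iff.1 hωω' e₁
        have k2 := Set.ext_iff.1 hωω' e₂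
        simp only [Finset.coe_insert, Finset.coe_singleton, Set.mem_inter_iff, Set.mem_insert_iff,
          Set.mem_singleton_iff, true_or, or_true, and_true] at k1 k2
        simp only [Set.mem_inter_iff, Set.mem_setOf_eq, k1, k2]
    have hd3 : DeterminedBy {ω : BondConfig V | e₃ ∉ ω} (↑({e₃} : Finset (Sym2 V))) :=
      (determinedBy_iff _ _).2 fun ω ω' hωω' => by
        have k := Set.ext_iff.1 hωω' e₃
        simp only [Finset.coe_singleton, Set.mem_inter_iff, Set.mem_singleton_iff, and_true] at k
        simp only [Set.mem_setOf_eq, k]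
    have hdisj : Disjoint ({e₁, e₂} : Finset (Sym2 V)) {e₃} :=
      Finset.disjoint_singleton_right.2 (by simp [Ne.symm h13, Ne.symm h23])
    have hdisj' : Disjoint ({e₁} : Finset (Sym2 V)) {e₂} := by simp [h12]
    have htwo : (prodBernoulli w').real ({ω | e₁ ∈ ω} ∩ {ω | e₂ ∈ ω}) = (w' e₁ : ℝ) * w' e₂ := by
      rw [prodBernoulli_real_inter_of_determinedBy_disjoint w' hdisj' (determinedBy_mem e₁) (determinedBy_mem e₂)
        (hm _) (hm _), prodBernoulli_real_setOf_mem, prodBernoulli_real_setOf_mem]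
    refine ⟨?_, ?_⟩
    · rw [prodBernoulli_real_inter_of_determinedBy_disjoint w' hdisj hd12 hd3 (hm _) (hm _), htwo,
        prodBernoulli_real_setOf_notMem]
    · rw [prodBernoulli_real_inter_of_determinedBy_disjoint w' hdisj hd12 (determinedBy_mem e₃) (hm _) (hm _), htwo,
        prodBernoulli_real_setOf_mem, mul_assoc]
  refine ⟨?_, ?_, ?_⟩
  · rw [htransfer (B := {ω | s(s, h) ∈ ω} ∩ {ω | s(h, u) ∈ ω} ∩ {ω | s(h, v) ∉ ω}) fun ω hω => by
      simp only [Set.mem_setOf_eq, Set.mem_inter_iff, hU ω hω, hV' ω hω]; tauto]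
    exact (hthree d12 d13 d23).1
  · rw [htransfer (B := {ω | s(s, h) ∈ ω} ∩ {ω | s(h, v) ∈ ω} ∩ {ω | s(h, u) ∉ ω}) fun ω hω => by
      simp only [Set.mem_setOf_eq, Set.mem_inter_iff, hU ω hω, hV' ω hω]; tauto]
    exact (hthree d13 d12 d23.symm).1
  · rw [htransfer (B := {ω | s(s, h) ∈ ω} ∩ {ω | s(h, u) ∈ ω} ∩ {ω | s(h, v) ∈ ω}) fun ω hω => by
      simp only [Set.mem_setOf_eq, Set.mem_inter_iff, hU ω hω, hV' ω hω]; tauto]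
    exact (hthree d12 d13 d23).2


end SahiRootSide

end Summit.CriticalPhenomena.PercolationContinuityZ3.Theorems
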